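/-
Copyright (c) 2026. All rights reserved.
Released under Apache 2.0 license as described in the file LICENSE.
-/
import Literature.Probability.FitznerVanDerHofstad2017.NobleBoundsNMidSZeroExit
import Literature.Probability.FitznerVanDerHofstad2017.NobleBoundsNClosedU
import Literature.Probability.FitznerVanDerHofstad2017.NobleBoundsNEndC1
import HarnessLib

/-!
# Fitzner–van der Hofstad (2017), §6.1 (6.4) / App. B: term-1 packages of a middle junction, variant `F‴`, over a CLOSED lower level (`a_k = ★`)

[FvdH17] = R. Fitzner, R. van der Hofstad, *Mean-field behavior for nearest-neighbor percolation in `d > 10`*,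
arXiv:1506.07977v2 (EJP 22 (2017), paper 43).  Page numbers refer to the arXiv version.

Continuation of `NobleBoundsNMidS` / `NobleBoundsNMidSZero` / `NobleBoundsNMidSOne` / `NobleBoundsNMidSOpen` /
`NobleBoundsNMidSZeroExit` (the cells `(a, c, a′)` of a MIDDLE junction `k`, `1 ≤ k ≤ M`, of variant `F‴`, kind
`midS`, (4.61), p. 41, for an OPEN lower level `k`, exit class `a ∈ {0,1,2}`) to the LOWER-`★` cells: the lower
level `k` of the junction is CLOSED (`a_k = ★`, kind `closed`, (4.58)/(4.62), p. 41: lines `v → t`, `t ⇔ z`,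
`t → u_k`, `z → u_k`, NO exit line), i.e. junction `k` is the special junction of the piece — its pin
`w_k = z_k` (and `z_k = u_{k-1}`), clause (4.64), p. 42.  These are the twins, one level down, of the `★`-rows
`nonempty_jPkg_end_star` of the terminal block (`NobleBoundsNEnd`) and of the UPPER-`★` cells of
`NobleBoundsNMidStar` / `NobleBoundsNMidStarZero` (there the upper level `k + 1` is closed).

The target of a lower-`★` cell is the `z_k = w_k` section of ROW `a = 2` of the first term of the pointwise middle
block (5.4) (p. 48) — the pinned section `𝟙{z = w} B_pt^{κ,2,a′}` of `NobleBoundsNAssemblyStar.secEopt`, §5.1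
"Elements of the bounds" (p. 49) — summand by summand:
`𝟙{z_k = w_k} A^{κ,2,c,*}(u_k,w_k,t_k,z_k) · A^{c,a′}(t_k,z_k,w_{k+1},u_{k+1})`, `c ∈ {0,1,2}` the inner class
(the class of the sausage `(t_k, z_k)` read on level `k + 1`), `a′` the exit class of level `k + 1`.  With no exit
line below, the cross-level letter `A^{κ,2,c,*}` is read on the pivotal bond `{u ←1̲→ v}` (level `k`) and the two
ENTRY lines `{v ↔ t}`, `t → z` of level `k + 1` only, the fourth line `{z ↔ w}` of the App. B row `(2, c)` (p. 75)
being witnessed trivially (`z = w`, witness `∅`; `genDisjOcc_triple_subset_quad` / `genDisjOcc_pair_subset_triple`);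
the exit letter `A^{c,a′}` of level `k + 1` is untouched (`NobleBoundsNMidSOpen.midSOpen_exitLetter` off the corner
`w_{k+1} ≠ t_k` for `a′ ∈ {1,2}`; the two-line readings of `NobleBoundsNMidS*` for `a′ = 0`).

* §A: the closed LOWER level at a middle junction in closed form — no lower slot is active
  (`jClosedL_not_act_lo`, twin of `jEnd_not_act_lo_inr`), the pin `z_k = u_{k-1} ∧ w_k = z_k`
  (`JFacts.pin_closedL`, twin of `JFacts.w_eq_z_of_inr`), and `b̄_k ∉ C̃_k` read as `v_k ≠ z_k`
  (`JFacts.v_ne_z_of_closedL`, twin of `JFacts.v_ne_z_of_open`).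
* §B: the three- and two-line readings of the letter `xb` without a lower line and the CORE package
  `nonempty_jPkg_midSLow_core` (grouping `glMidS12`, events `midEv … Set.univ`; twin of
  `nonempty_jPkg_midSOpen_core` with the lower membership discharged vacuously).
* §C: the six cells — `(★, c, 0)`, `c = 2, 1, 0` (`nonempty_jPkg_lowStar_two_zero / _one_zero / _zero_zero`,
  exit class `0` above: `w_{k+1} = u_{k+1}`) and `(★, c, a′)`, `a′ ∈ {1, 2}` off the corner `w_{k+1} ≠ t_k`
  (`nonempty_jPkg_lowStar_two_open / _one_open / _zero_open`) — and the inner-class-generic dispatch forms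
  `nonempty_jPkg_lowStar_zeroExit`, `nonempty_jPkg_lowStar_open`.

Not treated here (other nodes of the b2b-lace X2 ledger): the corner `w_{k+1} = t_k` (DIVERGENCE D77-R′), the
`★★` cells (lower AND upper level closed) and the variant-`F′/F″` (`σ = true`) lower-`★` cells.

Conventions: `d`-generic; nothing is cited as a fact; additive (no existing declaration is changed).  The
junction is written `k = i.castSucc = i₀.succ` (`i i₀ : Fin (M+1)`), as in `NobleBoundsNMidS`.
-/

noncomputable section

namespace Literature.Probability.FitznerVanDerHofstad2017

open Literature.Barriers.CriticalPhenomena Literature.Probability.Percolation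
open Literature.Probability.LatticeModels Literature.Combinatorics.SimpleGraph _root_.SimpleGraph
open _root_.MeasureTheory
open Literature.Probability.FitznerVanDerHofstad2017.NobleBlocks
open Literature.Probability.FitznerVanDerHofstad2017.NobleBlocks.LenIdx
open scoped ENNReal

variable {d : ℕ}

/-! ### A. The closed LOWER level of a middle junction in closed form -/

section ClosedL

variable (M : ℕ) (x : Site d) (b : Fin (M + 2) → Site d × Site d) (w t z : Fin (M + 2) → Site d)
  (a : Fin (M + 2) → Fin 3 ⊕ Unit) (τ : Fin (M + 1) → Bool × Fin 3)

/-- **A closed lower level owns no active slot**: at a junction `k = i₀ + 1 ≥ 1` whose lower level `k` is closed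
(`a_k = ★`: lines `v → t`, `t ⇔ z`, `t → u_k`, `z → u_k`, slots `4, 5` trivial — no exit line) no lower line
`lo j` is active.  Twin of `jEnd_not_act_lo_inr`.
[cite: FitznerVanDerHofstad2017, (4.58), (4.62) (arXiv:1506.07977v2 p. 41)] -/
theorem jClosedL_not_act_lo (i i₀ : Fin (M + 1)) (hk : i₀.succ = i.castSucc) {u₀ : Unit}
    (ha : a i.castSucc = Sum.inr u₀) (uB uT : Bool) (j : Fin 6) :
    ¬ (jctx M x b w t z a τ i.castSucc).Act uB uT (.lo j) := by
  rw [← hk, jSucc_act_lo_iff, pieceViews_mid_kd, show a i₀.succ = Sum.inr u₀ by rw [hk]; exact ha]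
  have hkd : midKind (Sum.inr u₀ : Fin 3 ⊕ Unit).isRight (τ i₀).1 = .closed := rfl
  rw [hkd]
  rintro ⟨rfl, h⟩
  exact h (by decide)

end ClosedL

section ClosedLFacts

variable {M : ℕ} {x : Site d} {b : Fin (M + 2) → Site d × Site d} {w t z : Fin (M + 2) → Site d}
  {a : Fin (M + 2) → Fin 3 ⊕ Unit} {c : Fin 3 ⊕ Unit} {τ : Fin (M + 1) → Bool × Fin 3}
  {ω : Fin (M + 3) → BondConfig (Site d)} {K₀ : Fin (M + 3) → Fin 6 → Set (Sym2 (Site d))}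

namespace JFacts

/-- **The pin of a closed lower level at a middle junction** `k = i₀ + 1`: `z_k = u_{k-1}` and `w_k = z_k` (the
piece is pinned at its special junction).  Twin of `JFacts.w_eq_z_of_inr` (closed level `M + 1`).
[cite: FitznerVanDerHofstad2017, (4.62), (4.64) (arXiv:1506.07977v2 pp. 41–42)] -/
theorem pin_closedL (h : JFacts M x b w t z a c τ ω K₀) (i i₀ : Fin (M + 1)) (hk : i₀.succ = i.castSucc)
    {u₀ : Unit} (ha : a i.castSucc = Sum.inr u₀) :
    z i.castSucc = (b i₀.castSucc).1 ∧ w i.castSucc = z i.castSucc := by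
  have ha₀ : a i₀.succ = Sum.inr u₀ := by rw [hk]; exact ha
  have hj := (h.junction i₀.succ).2
  rw [← Fin.succ_castSucc, pieceViews_closedU M x b w t z a τ i₀ ha₀,
    (views_succ (x := x) (b := b) (w := w) (a := a) (τ := τ) i₀.succ).2.1] at hj
  rw [← hk]
  exact hj rfl

/-- `b̄_k ∉ C̃_k` read on a CLOSED level `k = i₀ + 1`: the entry vertex `v_{k+1} = b̄_k` of level `k + 1` is not
the cut point `z_k` of its sausage.  Twin of `JFacts.v_ne_z_of_open`.
[cite: FitznerVanDerHofstad2017, (4.64) "{b̄_i ∉ C̃_i}" (arXiv:1506.07977v2 p. 42); (4.58), (4.62) (p. 41)] -/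
theorem v_ne_z_of_closedL (h : JFacts M x b w t z a c τ ω K₀) (i i₀ : Fin (M + 1)) (hk : i₀.succ = i.castSucc)
    {u₀ : Unit} (ha : a i.castSucc = Sum.inr u₀) : (b i.castSucc).2 ≠ z i.castSucc := by
  have ha₀ : a i₀.succ = Sum.inr u₀ := by rw [hk]; exact ha
  have hn : (b i₀.succ).2 ∉
      ({(b i₀.castSucc).2, t i₀.castSucc, z i₀.castSucc, w i₀.succ, z i₀.succ} : Set (Site d)) := by
    have h3 := (h.level i₀.castSucc.succ).2.2
    rw [pieceViews_closedU M x b w t z a τ i₀ ha₀] at h3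
    exact h3
  rw [hk] at hn
  exact fun he => hn (by simp [he])

end JFacts

end ClosedLFacts

/-! ### B. Readings of the letter `xb` without a lower line, and the core package -/

section Letter

variable (p : unitInterval) (M : ℕ) (x : Site d) (b : Fin (M + 2) → Site d × Site d) (w t z : Fin (M + 2) → Site d)
  (a : Fin (M + 2) → Fin 3 ⊕ Unit) (c : Fin 3 ⊕ Unit) (τ : Fin (M + 1) → Bool × Fin 3)

/-- **Three-line reading of the letter `xb`** under `glMidS12`, no lower line: the bond (level `k`) and the two
entry lines `v → t`, `t → z` (level `k + 1`).
[cite: FitznerVanDerHofstad2017, §4.2 (4.18) (arXiv:1506.07977v2 p. 35); §6.1 (6.4) (p. 58)] -/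
theorem junF_midSLow_xb_le₃ (i : Fin (M + 1)) (hσ : (τ i).1 = false) {a' : Fin 3} (ha' : a i.succ = Sum.inl a')
    (EB E0 E1 E2 E3 E4 X5 : Set (BondConfig (Site d))) :
    junF p M x b w t z a τ i.castSucc glMidS12 true false (midEv EB E0 E1 E2 E3 E4 X5) .xb ≤
      piPerc d p 2 (genDisjOcc ![EB, E0, E1] ![0, 1, 1]) := by
  refine junF_le_of_lines p M x b w t z a τ i.castSucc glMidS12 true false _ JIdx.xb
    ![JIdx.xb, .up 0, .up 1] (by decide) (fun m => ?_) ![0, 1, 1] (fun m => by fin_cases m <;> rfl)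
    ![EB, E0, E1] (by funext m; fin_cases m <;> rfl)
  fin_cases m
  · exact ⟨rfl, rfl⟩
  · exact ⟨(jMidS_act_up_iff M x b w t z a τ i hσ ha' true false 0).2 (by decide), rfl⟩
  · exact ⟨(jMidS_act_up_iff M x b w t z a τ i hσ ha' true false 1).2 (by decide), rfl⟩

/-- **Two-line reading of the letter `xb`** under `glMidS12`, no lower line, sausage slot dropped (`c = 0`:
`t = z`): the bond (level `k`) and the entry line `v → t` (level `k + 1`).
[cite: FitznerVanDerHofstad2017, §4.2 (4.18) (arXiv:1506.07977v2 p. 35); §6.1 (6.4) (p. 58)] -/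
theorem junF_midSLow_xb_le₂ (i : Fin (M + 1)) (hσ : (τ i).1 = false) {a' : Fin 3} (ha' : a i.succ = Sum.inl a')
    (EB E0 E1 E2 E3 E4 X5 : Set (BondConfig (Site d))) :
    junF p M x b w t z a τ i.castSucc glMidS12 true false (midEv EB E0 E1 E2 E3 E4 X5) .xb ≤
      piPerc d p 2 (genDisjOcc ![EB, E0] ![0, 1]) := by
  refine junF_le_of_lines p M x b w t z a τ i.castSucc glMidS12 true false _ JIdx.xb
    ![JIdx.xb, .up 0] (by decide) (fun m => ?_) ![0, 1] (fun m => by fin_cases m <;> rfl)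
    ![EB, E0] (by funext m; fin_cases m <;> rfl)
  fin_cases m
  · exact ⟨rfl, rfl⟩
  · exact ⟨(jMidS_act_up_iff M x b w t z a τ i hσ ha' true false 0).2 (by decide), rfl⟩

/-- **The core of the lower-`★` packages of variant `F‴`**: over a CLOSED lower level `k` (no active lower slot)
finitary events `E0, …, E4 ⊇` the witnesses of the five lines `v → t`, `t → z`, `t → w′`, `z → u′`, `w′ → u′` of
level `k + 1` (on the piece) and bounds of the two letters `xb` (bond + entry slots `0, 1`) and `up 2` (slots
`2, 3, 4`) give a package with target the product.  Twin of `nonempty_jPkg_midSOpen_core`.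
[cite: FitznerVanDerHofstad2017, §6.1 (6.4) (arXiv:1506.07977v2 p. 58); §4.4 (4.57)–(4.62), (4.65) (pp. 41, 43)] -/
theorem nonempty_jPkg_midSLow_core (i i₀ : Fin (M + 1)) (hk : i₀.succ = i.castSucc) (κ : Fin d × Bool)
    (hb : (b i.castSucc).2 = (b i.castSucc).1 + stepVec κ) (hσ : (τ i).1 = false) {u₀ : Unit}
    (ha : a i.castSucc = Sum.inr u₀) {a' : Fin 3} (ha' : a i.succ = Sum.inl a')
    (E0 E1 E2 E3 E4 : Set (BondConfig (Site d)))
    (h0 : IsFinitary E0) (h1 : IsFinitary E1) (h2 : IsFinitary E2) (h3 : IsFinitary E3) (h4 : IsFinitary E4)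
    (hmem : ∀ ω K₀, JFacts M x b w t z a c τ ω K₀ →
      K₀ i.castSucc.succ 0 ∈ E0 ∧ K₀ i.castSucc.succ 1 ∈ E1 ∧ K₀ i.castSucc.succ 2 ∈ E2 ∧
        K₀ i.castSucc.succ 3 ∈ E3 ∧ K₀ i.castSucc.succ 4 ∈ E4)
    {T₁ T₂ : ℝ≥0∞}
    (hrow₁ : junF p M x b w t z a τ i.castSucc glMidS12 true false
      (midEv (event (eq 1) (b i.castSucc).1 (b i.castSucc).2) E0 E1 E2 E3 E4 Set.univ) .xb ≤ T₁)
    (hrow₂ : junF p M x b w t z a τ i.castSucc glMidS12 true false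
      (midEv (event (eq 1) (b i.castSucc).1 (b i.castSucc).2) E0 E1 E2 E3 E4 Set.univ) (.up 2) ≤ T₂) :
    Nonempty (JPkg p (jctx M x b w t z a τ i.castSucc) (JFacts M x b w t z a c τ) (T₁ * T₂)) := by
  have huv : (b i.castSucc).1 ≠ (b i.castSucc).2 := by
    rw [hb]; exact (zdGraph_adj_iff_stepVec _ _ |>.2 ⟨κ, rfl⟩).ne
  refine nonempty_jPkg_of_joint p i.castSucc glMidS12 true
    (midEv (event (eq 1) (b i.castSucc).1 (b i.castSucc).2) E0 E1 E2 E3 E4 Set.univ)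
    (isFinitary_midEv _ _ _ _ _ _ _ (isFinitary_event _ _ _) h0 h1 h2 h3 h4 isFinitary_univ)
    (fun _ => by rw [midEv_xb]; exact singleton_mem_event_eq_one huv)
    (fun j j' _ _ hg => glMidS12_entry M x b w t z a τ i hσ ha' j j' hg)
    (fun ω K₀ hF => ⟨fun j hj => ?_, fun j hj => ?_⟩) ?_
  · -- a closed lower level owns no active slot
    exact absurd hj (jClosedL_not_act_lo M x b w t z a τ i i₀ hk ha true false j)
  · -- the witnesses of level `k + 1`
    have hj5 : j ≠ 5 := (jMidS_act_up_iff M x b w t z a τ i hσ ha' true false j).1 hj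
    obtain ⟨m0, m1, m2, m3, m4⟩ := hmem ω K₀ hF
    exact mem_midEv_up _ _ _ _ _ _ _ m0 m1 m2 m3 m4 j hj5
  · -- two genuine letters
    exact (prod_junF_le₂ p M x b w t z a τ i.castSucc glMidS12 true false _
      (show JIdx.xb ≠ JIdx.up 2 by decide)).trans (mul_le_mul' hrow₁ hrow₂)

end Letter

/-! ### C. The lower-`★` cells of a middle junction of variant `F‴` -/

section Packages

variable (p : unitInterval) (M : ℕ) (x : Site d) (b : Fin (M + 2) → Site d × Site d) (w t z : Fin (M + 2) → Site d)
  (a : Fin (M + 2) → Fin 3 ⊕ Unit) (c : Fin 3 ⊕ Unit) (τ : Fin (M + 1) → Bool × Fin 3)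

/-- **Cell `(★, 2, 0)`, variant `F‴`, of a middle junction `k = i₀ + 1 ≤ M` over a CLOSED lower level**: a package
with target `𝟙{z_k = w_k} A^{κ,2,2,*}(u_k,w_k,t_k,z_k) · A^{2,0}(t_k,z_k,w_{k+1},u_{k+1})` — the `c = 2` summand of
the pinned section of the first term of (5.4).  Off the pin `z_k = w_k` the piece is empty; on it the entry letter
is read on the bond, `{v ↔ t}` and `{t ←2→ z}` (inner class `2`) with the trivially witnessed `{z ↔ w}`, and the
exit letter on `{t ←1→ u′}`, `{u′ ↔ z}` (exit class `0` above: `w′ = u′`; `t ≠ u′` by the canonical clause of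
`F‴`).
[cite: FitznerVanDerHofstad2017, §6.1 (6.4), "Case a ≥ 2", "Case b ≥ 2" (arXiv:1506.07977v2 pp. 58–59); §5.1 (5.4) (p. 48) and "Elements of the bounds" (p. 49); (4.62), (4.64) (pp. 41–42); App. B (pp. 74–75)] -/
theorem nonempty_jPkg_lowStar_two_zero (i i₀ : Fin (M + 1)) (hk : i₀.succ = i.castSucc) (κ : Fin d × Bool)
    (hb : (b i.castSucc).2 = (b i.castSucc).1 + stepVec κ) (hσ : (τ i).1 = false) (hc2 : (τ i).2 = 2)
    {u₀ : Unit} (ha : a i.castSucc = Sum.inr u₀) (ha' : a i.succ = Sum.inl 0) :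
    Nonempty (JPkg p (jctx M x b w t z a τ i.castSucc) (JFacts M x b w t z a c τ)
      ((if z i.castSucc = w i.castSucc then
          blockAiotaSt (Letters.perc d p) κ 2 2 (b i.castSucc).1 (w i.castSucc) (t i.castSucc) (z i.castSucc)
        else 0) *
        blockA (Letters.perc d p) 2 0 (t i.castSucc) (z i.castSucc) (w i.succ) (b i.succ).1)) := by
  -- the pin: off `z = w` the piece is empty
  by_cases hzw : z i.castSucc = w i.castSucc
  swap
  · rw [if_neg hzw, zero_mul]
    exact ⟨JPkg.vacuous p _ _ (fun ω K₀ hF => hzw (hF.pin_closedL i i₀ hk ha).2.symm) _⟩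
  rw [if_pos hzw]
  -- degenerate parameters: the piece is empty
  by_cases hP : t i.castSucc ≠ z i.castSucc ∧ w i.succ = (b i.succ).1 ∧ t i.castSucc ≠ (b i.succ).1
  swap
  · refine ⟨JPkg.vacuous p _ _ (fun ω K₀ hF => hP ?_) _⟩
    exact ⟨hF.t_ne_z_of_innerClass_ne_zero i (by rw [hc2]; decide), hF.w_eq_of_exitClass_zero i.succ ha',
      (hF.canon_midS i hσ ha').2⟩
  obtain ⟨htz, hwy, hty⟩ := hP
  rw [hwy]
  have h := nonempty_jPkg_midSLow_core p M x b w t z a c τ i i₀ hk κ hb hσ ha ha'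
    (event (ge 0) (b i.castSucc).2 (t i.castSucc)) (event (ge 2) (t i.castSucc) (z i.castSucc))
    (event (ge 1) (t i.castSucc) (b i.succ).1) (event (ge 0) (b i.succ).1 (z i.castSucc)) Set.univ
    (isFinitary_event _ _ _) (isFinitary_event _ _ _) (isFinitary_event _ _ _) (isFinitary_event _ _ _)
    isFinitary_univ (fun ω K₀ hF => ?_)
    (T₁ := blockAiotaSt (Letters.perc d p) κ 2 2 (b i.castSucc).1 (w i.castSucc) (t i.castSucc) (z i.castSucc))
    (T₂ := blockA (Letters.perc d p) 2 0 (t i.castSucc) (z i.castSucc) (b i.succ).1 (b i.succ).1) ?_ ?_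
  · exact h
  · obtain ⟨h0, h1, h2, h3, -⟩ := hF.conn_midS i hσ ha'
    rw [hwy] at h2
    refine ⟨?_, ?_, ?_, ?_, Set.mem_univ _⟩
    · rw [event_ge]; exact mem_openConnGe_zero_of_mem h0
    · rw [event_ge]
      exact mem_openConnGe_two_of_notMem h1 htz fun hm =>
        (hF.innerClass_two i hc2).2 (hF.witness_subset _ 1 hm)
    · rw [event_ge]; exact mem_openConnGe_one_of_ne h2 hty
    · rw [event_comm, event_ge]; exact mem_openConnGe_zero_of_mem h3
  · -- `A^{κ,2,2,*}`: bond, `v → t`, `t ⇔ z` (+ the trivially witnessed `z ↔ w`)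
    refine (junF_midSLow_xb_le₃ p M x b w t z a τ i hσ ha' _ _ _ _ _ _ _).trans ?_
    refine (measure_mono (genDisjOcc_triple_subset_quad _ _ _ (event (ge 0) (z i.castSucc) (w i.castSucc))
      (by rw [hzw]; exact empty_mem_event_ge_zero_self (w i.castSucc)) 0 1 1 0)).trans ?_
    exact piPerc_midS_two_two_le_blockAiotaSt p hb ![0, 1, 1, 0]
  · -- `A^{2,0}`: `t → u′`, `u′ → z` on level `k + 1`
    refine (junF_midSOpen_up_le₂ p M x b w t z a τ i hσ ha' _ _ _ _ _ _ _).trans ?_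
    exact piPerc_midS_two_zero_le_blockA p _

/-- **Cell `(★, 1, 0)`, variant `F‴`, of a middle junction `k = i₀ + 1 ≤ M` over a CLOSED lower level**: a package
with target `𝟙{z_k = w_k} A^{κ,2,1,*}(u_k,w_k,t_k,z_k) · A^{1,0}(t_k,z_k,w_{k+1},u_{k+1})` — the `c = 1` summand of
the pinned section of the first term of (5.4).  Inner class `1` makes the sausage line of level `k + 1` the open
bond `{t ←1̲→ z}` itself (`Conds.tzNF`) and `z ~ t`; exit class `0` above gives `{t ←1→ u′}`, `{u′ ←1→ z}`
(`t, z ≠ u′`, canonical clause of `F‴`).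
[cite: FitznerVanDerHofstad2017, §6.1 (6.4), "Case a ≥ 2", "Case b = 1" (arXiv:1506.07977v2 pp. 58–59); §5.1 (5.4) (p. 48) and "Elements of the bounds" (p. 49); (4.62), (4.64) (pp. 41–42); App. B (pp. 74–75)] -/
theorem nonempty_jPkg_lowStar_one_zero (i i₀ : Fin (M + 1)) (hk : i₀.succ = i.castSucc) (κ : Fin d × Bool)
    (hb : (b i.castSucc).2 = (b i.castSucc).1 + stepVec κ) (hσ : (τ i).1 = false) (hc1 : (τ i).2 = 1)
    {u₀ : Unit} (ha : a i.castSucc = Sum.inr u₀) (ha' : a i.succ = Sum.inl 0) :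
    Nonempty (JPkg p (jctx M x b w t z a τ i.castSucc) (JFacts M x b w t z a c τ)
      ((if z i.castSucc = w i.castSucc then
          blockAiotaSt (Letters.perc d p) κ 2 1 (b i.castSucc).1 (w i.castSucc) (t i.castSucc) (z i.castSucc)
        else 0) *
        blockA (Letters.perc d p) 1 0 (t i.castSucc) (z i.castSucc) (w i.succ) (b i.succ).1)) := by
  -- the pin: off `z = w` the piece is empty
  by_cases hzw : z i.castSucc = w i.castSucc
  swap
  · rw [if_neg hzw, zero_mul]
    exact ⟨JPkg.vacuous p _ _ (fun ω K₀ hF => hzw (hF.pin_closedL i i₀ hk ha).2.symm) _⟩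
  rw [if_pos hzw]
  -- degenerate parameters: the piece is empty
  by_cases hP : (zdGraph d).Adj (t i.castSucc) (z i.castSucc) ∧ w i.succ = (b i.succ).1 ∧
      t i.castSucc ≠ (b i.succ).1 ∧ z i.castSucc ≠ (b i.succ).1
  swap
  · refine ⟨JPkg.vacuous p _ _ (fun ω K₀ hF => hP ?_) _⟩
    exact ⟨(hF.innerClass_one i hc1).2.2, hF.w_eq_of_exitClass_zero i.succ ha', (hF.canon_midS i hσ ha').2,
      (hF.canon_midS i hσ ha').1⟩
  obtain ⟨hadj, hwy, hty, hzy⟩ := hP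
  have htz : t i.castSucc ≠ z i.castSucc := hadj.ne
  obtain ⟨κ', hκ'⟩ := (zdGraph_adj_iff_stepVec _ _).1 hadj
  rw [hwy]
  have h := nonempty_jPkg_midSLow_core p M x b w t z a c τ i i₀ hk κ hb hσ ha ha'
    (event (ge 0) (b i.castSucc).2 (t i.castSucc)) (event (eq 1) (t i.castSucc) (z i.castSucc))
    (event (ge 1) (t i.castSucc) (b i.succ).1) (event (ge 1) (b i.succ).1 (z i.castSucc)) Set.univ
    (isFinitary_event _ _ _) (isFinitary_event _ _ _) (isFinitary_event _ _ _) (isFinitary_event _ _ _)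
    isFinitary_univ (fun ω K₀ hF => ?_)
    (T₁ := blockAiotaSt (Letters.perc d p) κ 2 1 (b i.castSucc).1 (w i.castSucc) (t i.castSucc) (z i.castSucc))
    (T₂ := blockA (Letters.perc d p) 1 0 (t i.castSucc) (z i.castSucc) (b i.succ).1 (b i.succ).1) ?_ ?_
  · exact h
  · obtain ⟨h0, -, h2, h3, -⟩ := hF.conn_midS i hσ ha'
    rw [hwy] at h2
    have hK := hF.tz_witness_midS i hσ ha' htz (hF.innerClass_one i hc1).2.1
    refine ⟨?_, ?_, ?_, ?_, Set.mem_univ _⟩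
    · rw [event_ge]; exact mem_openConnGe_zero_of_mem h0
    · rw [hK]; exact singleton_mem_event_eq_one htz
    · rw [event_ge]; exact mem_openConnGe_one_of_ne h2 hty
    · rw [event_comm, event_ge]; exact mem_openConnGe_one_of_ne h3 hzy
  · -- `A^{κ,2,1,*}`: bond, `v → t`, the open sausage bond (+ the trivially witnessed `z ↔ w`)
    refine (junF_midSLow_xb_le₃ p M x b w t z a τ i hσ ha' _ _ _ _ _ _ _).trans ?_
    refine (measure_mono (genDisjOcc_triple_subset_quad _ _ _ (event (ge 0) (z i.castSucc) (w i.castSucc))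
      (by rw [hzw]; exact empty_mem_event_ge_zero_self (w i.castSucc)) 0 1 1 0)).trans ?_
    exact piPerc_midS_two_one_le_blockAiotaSt p hb ![0, 1, 1, 0]
  · -- `A^{1,0}`: `t → u′`, `u′ → z` on level `k + 1`, `z ~ t`
    refine (junF_midSOpen_up_le₂ p M x b w t z a τ i hσ ha' _ _ _ _ _ _ _).trans ?_
    exact piPerc_midS_one_zero_le_blockA p hκ' _

/-- **Cell `(★, 0, 0)`, variant `F‴`, of a middle junction `k = i₀ + 1 ≤ M` over a CLOSED lower level**: a package
with target `𝟙{z_k = w_k} A^{κ,2,0,*}(u_k,w_k,t_k,z_k) · A^{0,0}(t_k,z_k,w_{k+1},u_{k+1})` — the `c = 0` summand of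
the pinned section of the first term of (5.4).  Inner class `0` identifies `z_k = t_k`, so the entry line reads
`{v ←1→ t}` (`v = b̄_k ≠ z_k`, (4.64)) and the entry letter is the triangle `𝓣_{1̲,1,0}` on the bond, `{v ←1→ t}`
and the trivially witnessed `{t ↔ w}` (`t = z = w`); exit class `0` above makes the two lines `t → w′`, `z → u′`
of level `k + 1` a double connection `t ⇔ u′` (`t ≠ u′`, canonical clause of `F‴`).
[cite: FitznerVanDerHofstad2017, §6.1 (6.4), "Case a ≥ 2", "Case b = 0" (arXiv:1506.07977v2 pp. 58–59); §5.1 (5.4) (p. 48) and "Elements of the bounds" (p. 49); (4.62), (4.64) (pp. 41–42); App. B (pp. 74–75)] -/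
theorem nonempty_jPkg_lowStar_zero_zero (i i₀ : Fin (M + 1)) (hk : i₀.succ = i.castSucc) (κ : Fin d × Bool)
    (hb : (b i.castSucc).2 = (b i.castSucc).1 + stepVec κ) (hσ : (τ i).1 = false) (hc0 : (τ i).2 = 0)
    {u₀ : Unit} (ha : a i.castSucc = Sum.inr u₀) (ha' : a i.succ = Sum.inl 0) :
    Nonempty (JPkg p (jctx M x b w t z a τ i.castSucc) (JFacts M x b w t z a c τ)
      ((if z i.castSucc = w i.castSucc then
          blockAiotaSt (Letters.perc d p) κ 2 0 (b i.castSucc).1 (w i.castSucc) (t i.castSucc) (z i.castSucc)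
        else 0) *
        blockA (Letters.perc d p) 0 0 (t i.castSucc) (z i.castSucc) (w i.succ) (b i.succ).1)) := by
  -- the pin: off `z = w` the piece is empty
  by_cases hzw : z i.castSucc = w i.castSucc
  swap
  · rw [if_neg hzw, zero_mul]
    exact ⟨JPkg.vacuous p _ _ (fun ω K₀ hF => hzw (hF.pin_closedL i i₀ hk ha).2.symm) _⟩
  rw [if_pos hzw]
  -- degenerate parameters: the piece is empty
  by_cases hP : z i.castSucc = t i.castSucc ∧ w i.succ = (b i.succ).1 ∧ t i.castSucc ≠ (b i.succ).1 ∧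
      (b i.castSucc).2 ≠ z i.castSucc
  swap
  · refine ⟨JPkg.vacuous p _ _ (fun ω K₀ hF => hP ?_) _⟩
    exact ⟨(hF.t_eq_z_of_innerClass_zero i hc0).symm, hF.w_eq_of_exitClass_zero i.succ ha',
      (hF.canon_midS i hσ ha').2, hF.v_ne_z_of_closedL i i₀ hk ha⟩
  obtain ⟨hzt, hwy, hty, hvz⟩ := hP
  have hvt : (b i.castSucc).2 ≠ t i.castSucc := by rw [← hzt]; exact hvz
  have htw : t i.castSucc = w i.castSucc := hzt.symm.trans hzw
  rw [hwy, hzt]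
  have h := nonempty_jPkg_midSLow_core p M x b w t z a c τ i i₀ hk κ hb hσ ha ha'
    (event (ge 1) (b i.castSucc).2 (t i.castSucc)) Set.univ (event (ge 0) (t i.castSucc) (b i.succ).1)
    (event (ge 0) (t i.castSucc) (b i.succ).1) Set.univ
    (isFinitary_event _ _ _) isFinitary_univ (isFinitary_event _ _ _) (isFinitary_event _ _ _) isFinitary_univ
    (fun ω K₀ hF => ?_)
    (T₁ := blockAiotaSt (Letters.perc d p) κ 2 0 (b i.castSucc).1 (w i.castSucc) (t i.castSucc) (t i.castSucc))
    (T₂ := blockA (Letters.perc d p) 0 0 (t i.castSucc) (t i.castSucc) (b i.succ).1 (b i.succ).1) ?_ ?_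
  · exact h
  · obtain ⟨h0, -, h2, h3, -⟩ := hF.conn_midS i hσ ha'
    rw [hwy] at h2
    rw [hzt] at h3
    refine ⟨?_, Set.mem_univ _, ?_, ?_, Set.mem_univ _⟩
    · rw [event_ge]; exact mem_openConnGe_one_of_ne h0 hvt
    · rw [event_ge]; exact mem_openConnGe_zero_of_mem h2
    · rw [event_ge]; exact mem_openConnGe_zero_of_mem h3
  · -- `A^{κ,2,0,*}`: bond, `v → t` (+ the trivially witnessed `t ↔ w`)
    refine (junF_midSLow_xb_le₂ p M x b w t z a τ i hσ ha' _ _ _ _ _ _ _).trans ?_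
    refine (measure_mono (genDisjOcc_pair_subset_triple _ _ (event (ge 0) (t i.castSucc) (w i.castSucc))
      (by rw [htw]; exact empty_mem_event_ge_zero_self (w i.castSucc)) 0 1 0)).trans ?_
    exact piPerc_midS_two_zero_le_blockAiotaSt p hb ![0, 1, 0]
  · -- `A^{0,0}`: the double connection `t ⇔ u′` on level `k + 1`
    refine (junF_midSOpen_up_le₂ p M x b w t z a τ i hσ ha' _ _ _ _ _ _ _).trans ?_
    exact piPerc_midS_zero_zero_le_blockA p hty _ rfl

/-- **Cells `(★, 2, a′)`, `a′ ∈ {1,2}`, variant `F‴`, of a middle junction `k = i₀ + 1 ≤ M` over a CLOSED lower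
level, off the corner `w_{k+1} ≠ t_k`**: a package with target
`𝟙{z_k = w_k} A^{κ,2,2,*}(u_k,w_k,t_k,z_k) · A^{2,a′}(t_k,z_k,w_{k+1},u_{k+1})` — the `c = 2` summand of the pinned
section of the first term of (5.4).  The exit letter is `midSOpen_exitLetter` (`{t ←1→ w′}`, the class-`a′` leg
`{w′ ←j_{a′}→ u′}`, `{u′ ↔ z}`).
[cite: FitznerVanDerHofstad2017, §6.1 (6.4), "Case a ≥ 2", "Case b ≥ 2" (arXiv:1506.07977v2 pp. 58–59); §5.1 (5.4) (p. 48) and "Elements of the bounds" (p. 49); (4.62), (4.64) (pp. 41–42); App. B (pp. 74–75)] -/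
theorem nonempty_jPkg_lowStar_two_open (i i₀ : Fin (M + 1)) (hk : i₀.succ = i.castSucc) (κ : Fin d × Bool)
    (hb : (b i.castSucc).2 = (b i.castSucc).1 + stepVec κ) (hσ : (τ i).1 = false) (hc2 : (τ i).2 = 2)
    {u₀ : Unit} (ha : a i.castSucc = Sum.inr u₀) {a' : Fin 3} (ha' : a i.succ = Sum.inl a') (ha'0 : a' ≠ 0)
    (hwt : w i.succ ≠ t i.castSucc) :
    Nonempty (JPkg p (jctx M x b w t z a τ i.castSucc) (JFacts M x b w t z a c τ)
      ((if z i.castSucc = w i.castSucc then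
          blockAiotaSt (Letters.perc d p) κ 2 2 (b i.castSucc).1 (w i.castSucc) (t i.castSucc) (z i.castSucc)
        else 0) *
        blockA (Letters.perc d p) 2 a' (t i.castSucc) (z i.castSucc) (w i.succ) (b i.succ).1)) := by
  -- the pin: off `z = w` the piece is empty
  by_cases hzw : z i.castSucc = w i.castSucc
  swap
  · rw [if_neg hzw, zero_mul]
    exact ⟨JPkg.vacuous p _ _ (fun ω K₀ hF => hzw (hF.pin_closedL i i₀ hk ha).2.symm) _⟩
  rw [if_pos hzw]
  -- degenerate parameters: the piece is empty
  by_cases hP : (t i.castSucc ≠ (b i.succ).1 ∧ (a' ≠ 0 → w i.succ ≠ (b i.succ).1) ∧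
      ((τ i).2 = 0 → t i.castSucc = z i.castSucc) ∧ ((τ i).2 = 1 → (zdGraph d).Adj (t i.castSucc) (z i.castSucc))) ∧
      t i.castSucc ≠ z i.castSucc
  swap
  · refine ⟨JPkg.vacuous p _ _ (fun ω K₀ hF => hP ?_) _⟩
    exact ⟨⟨(hF.canon_midS i hσ ha').2, fun h0 => (hF.u_ne_w_of_exitClass_ne_zero i.succ ha' h0).symm,
      hF.t_eq_z_of_innerClass_zero i, fun h1 => (hF.innerClass_one i h1).2.2⟩,
      hF.t_ne_z_of_innerClass_ne_zero i (by rw [hc2]; decide)⟩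
  obtain ⟨hQ, htz⟩ := hP
  obtain ⟨E2, E3, E4, f2, f3, f4, hmem₂, hrow₂⟩ :=
    midSOpen_exitLetter p M x b w t z a c τ i hσ ha' ha'0 2 hwt hQ hc2
  refine nonempty_jPkg_midSLow_core p M x b w t z a c τ i i₀ hk κ hb hσ ha ha'
    (event (ge 0) (b i.castSucc).2 (t i.castSucc)) (event (ge 2) (t i.castSucc) (z i.castSucc)) E2 E3 E4
    (isFinitary_event _ _ _) (isFinitary_event _ _ _) f2 f3 f4
    (fun ω K₀ hF => ⟨?_, ?_, (hmem₂ ω K₀ hF).1, (hmem₂ ω K₀ hF).2.1, (hmem₂ ω K₀ hF).2.2⟩) ?_ (hrow₂ _ _ _ _)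
  · obtain ⟨h0, -⟩ := hF.conn_midS i hσ ha'
    rw [event_ge]; exact mem_openConnGe_zero_of_mem h0
  · obtain ⟨-, h1, -⟩ := hF.conn_midS i hσ ha'
    rw [event_ge]
    exact mem_openConnGe_two_of_notMem h1 htz fun hm => (hF.innerClass_two i hc2).2 (hF.witness_subset _ 1 hm)
  · -- `A^{κ,2,2,*}`: bond, `v → t`, `t ⇔ z` (+ the trivially witnessed `z ↔ w`)
    refine (junF_midSLow_xb_le₃ p M x b w t z a τ i hσ ha' _ _ _ _ _ _ _).trans ?_
    refine (measure_mono (genDisjOcc_triple_subset_quad _ _ _ (event (ge 0) (z i.castSucc) (w i.castSucc))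
      (by rw [hzw]; exact empty_mem_event_ge_zero_self (w i.castSucc)) 0 1 1 0)).trans ?_
    exact piPerc_midS_two_two_le_blockAiotaSt p hb ![0, 1, 1, 0]

/-- **Cells `(★, 1, a′)`, `a′ ∈ {1,2}`, variant `F‴`, of a middle junction `k = i₀ + 1 ≤ M` over a CLOSED lower
level, off the corner `w_{k+1} ≠ t_k`**: a package with target
`𝟙{z_k = w_k} A^{κ,2,1,*}(u_k,w_k,t_k,z_k) · A^{1,a′}(t_k,z_k,w_{k+1},u_{k+1})` — the `c = 1` summand of the pinned
section of the first term of (5.4).  The sausage line of level `k + 1` is the open bond `{t ←1̲→ z}` itself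
(`Conds.tzNF`).
[cite: FitznerVanDerHofstad2017, §6.1 (6.4), "Case a ≥ 2", "Case b = 1" (arXiv:1506.07977v2 pp. 58–59); §5.1 (5.4) (p. 48) and "Elements of the bounds" (p. 49); (4.62), (4.64) (pp. 41–42); App. B (pp. 74–75)] -/
theorem nonempty_jPkg_lowStar_one_open (i i₀ : Fin (M + 1)) (hk : i₀.succ = i.castSucc) (κ : Fin d × Bool)
    (hb : (b i.castSucc).2 = (b i.castSucc).1 + stepVec κ) (hσ : (τ i).1 = false) (hc1 : (τ i).2 = 1)
    {u₀ : Unit} (ha : a i.castSucc = Sum.inr u₀) {a' : Fin 3} (ha' : a i.succ = Sum.inl a') (ha'0 : a' ≠ 0)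
    (hwt : w i.succ ≠ t i.castSucc) :
    Nonempty (JPkg p (jctx M x b w t z a τ i.castSucc) (JFacts M x b w t z a c τ)
      ((if z i.castSucc = w i.castSucc then
          blockAiotaSt (Letters.perc d p) κ 2 1 (b i.castSucc).1 (w i.castSucc) (t i.castSucc) (z i.castSucc)
        else 0) *
        blockA (Letters.perc d p) 1 a' (t i.castSucc) (z i.castSucc) (w i.succ) (b i.succ).1)) := by
  -- the pin: off `z = w` the piece is empty
  by_cases hzw : z i.castSucc = w i.castSucc
  swap
  · rw [if_neg hzw, zero_mul]
    exact ⟨JPkg.vacuous p _ _ (fun ω K₀ hF => hzw (hF.pin_closedL i i₀ hk ha).2.symm) _⟩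
  rw [if_pos hzw]
  -- degenerate parameters: the piece is empty
  by_cases hP : (t i.castSucc ≠ (b i.succ).1 ∧ (a' ≠ 0 → w i.succ ≠ (b i.succ).1) ∧
      ((τ i).2 = 0 → t i.castSucc = z i.castSucc) ∧ ((τ i).2 = 1 → (zdGraph d).Adj (t i.castSucc) (z i.castSucc))) ∧
      t i.castSucc ≠ z i.castSucc
  swap
  · refine ⟨JPkg.vacuous p _ _ (fun ω K₀ hF => hP ?_) _⟩
    exact ⟨⟨(hF.canon_midS i hσ ha').2, fun h0 => (hF.u_ne_w_of_exitClass_ne_zero i.succ ha' h0).symm,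
      hF.t_eq_z_of_innerClass_zero i, fun h1 => (hF.innerClass_one i h1).2.2⟩,
      hF.t_ne_z_of_innerClass_ne_zero i (by rw [hc1]; decide)⟩
  obtain ⟨hQ, htz⟩ := hP
  obtain ⟨E2, E3, E4, f2, f3, f4, hmem₂, hrow₂⟩ :=
    midSOpen_exitLetter p M x b w t z a c τ i hσ ha' ha'0 1 hwt hQ hc1
  refine nonempty_jPkg_midSLow_core p M x b w t z a c τ i i₀ hk κ hb hσ ha ha'
    (event (ge 0) (b i.castSucc).2 (t i.castSucc)) (event (eq 1) (t i.castSucc) (z i.castSucc)) E2 E3 E4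
    (isFinitary_event _ _ _) (isFinitary_event _ _ _) f2 f3 f4
    (fun ω K₀ hF => ⟨?_, ?_, (hmem₂ ω K₀ hF).1, (hmem₂ ω K₀ hF).2.1, (hmem₂ ω K₀ hF).2.2⟩) ?_ (hrow₂ _ _ _ _)
  · obtain ⟨h0, -⟩ := hF.conn_midS i hσ ha'
    rw [event_ge]; exact mem_openConnGe_zero_of_mem h0
  · -- the open sausage bond is its own witness
    rw [hF.tz_witness_midS i hσ ha' htz (hF.innerClass_one i hc1).2.1]
    exact singleton_mem_event_eq_one htz
  · -- `A^{κ,2,1,*}`: bond, `v → t`, the open sausage bond (+ the trivially witnessed `z ↔ w`)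
    refine (junF_midSLow_xb_le₃ p M x b w t z a τ i hσ ha' _ _ _ _ _ _ _).trans ?_
    refine (measure_mono (genDisjOcc_triple_subset_quad _ _ _ (event (ge 0) (z i.castSucc) (w i.castSucc))
      (by rw [hzw]; exact empty_mem_event_ge_zero_self (w i.castSucc)) 0 1 1 0)).trans ?_
    exact piPerc_midS_two_one_le_blockAiotaSt p hb ![0, 1, 1, 0]

/-- **Cells `(★, 0, a′)`, `a′ ∈ {1,2}`, variant `F‴`, of a middle junction `k = i₀ + 1 ≤ M` over a CLOSED lower
level, off the corner `w_{k+1} ≠ t_k`**: a package with target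
`𝟙{z_k = w_k} A^{κ,2,0,*}(u_k,w_k,t_k,z_k) · A^{0,a′}(t_k,z_k,w_{k+1},u_{k+1})` — the `c = 0` summand of the pinned
section of the first term of (5.4).  Inner class `0` identifies `z_k = t_k`; the entry letter is the triangle on the
bond, `{v ←1→ t}` (`v = b̄_k ≠ z_k`, (4.64)) and the trivially witnessed `{t ↔ w}`.
[cite: FitznerVanDerHofstad2017, §6.1 (6.4), "Case a ≥ 2", "Case b = 0" (arXiv:1506.07977v2 pp. 58–59); §5.1 (5.4) (p. 48) and "Elements of the bounds" (p. 49); (4.62), (4.64) (pp. 41–42); App. B (pp. 74–75)] -/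
theorem nonempty_jPkg_lowStar_zero_open (i i₀ : Fin (M + 1)) (hk : i₀.succ = i.castSucc) (κ : Fin d × Bool)
    (hb : (b i.castSucc).2 = (b i.castSucc).1 + stepVec κ) (hσ : (τ i).1 = false) (hc0 : (τ i).2 = 0)
    {u₀ : Unit} (ha : a i.castSucc = Sum.inr u₀) {a' : Fin 3} (ha' : a i.succ = Sum.inl a') (ha'0 : a' ≠ 0)
    (hwt : w i.succ ≠ t i.castSucc) :
    Nonempty (JPkg p (jctx M x b w t z a τ i.castSucc) (JFacts M x b w t z a c τ)
      ((if z i.castSucc = w i.castSucc then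
          blockAiotaSt (Letters.perc d p) κ 2 0 (b i.castSucc).1 (w i.castSucc) (t i.castSucc) (z i.castSucc)
        else 0) *
        blockA (Letters.perc d p) 0 a' (t i.castSucc) (z i.castSucc) (w i.succ) (b i.succ).1)) := by
  -- the pin: off `z = w` the piece is empty
  by_cases hzw : z i.castSucc = w i.castSucc
  swap
  · rw [if_neg hzw, zero_mul]
    exact ⟨JPkg.vacuous p _ _ (fun ω K₀ hF => hzw (hF.pin_closedL i i₀ hk ha).2.symm) _⟩
  rw [if_pos hzw]
  -- degenerate parameters: the piece is empty
  by_cases hP : (t i.castSucc ≠ (b i.succ).1 ∧ (a' ≠ 0 → w i.succ ≠ (b i.succ).1) ∧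
      ((τ i).2 = 0 → t i.castSucc = z i.castSucc) ∧ ((τ i).2 = 1 → (zdGraph d).Adj (t i.castSucc) (z i.castSucc))) ∧
      (b i.castSucc).2 ≠ z i.castSucc
  swap
  · refine ⟨JPkg.vacuous p _ _ (fun ω K₀ hF => hP ?_) _⟩
    exact ⟨⟨(hF.canon_midS i hσ ha').2, fun h0 => (hF.u_ne_w_of_exitClass_ne_zero i.succ ha' h0).symm,
      hF.t_eq_z_of_innerClass_zero i, fun h1 => (hF.innerClass_one i h1).2.2⟩,
      hF.v_ne_z_of_closedL i i₀ hk ha⟩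
  obtain ⟨hQ, hvz⟩ := hP
  have htz : t i.castSucc = z i.castSucc := hQ.2.2.1 hc0
  have htw : t i.castSucc = w i.castSucc := htz.trans hzw
  obtain ⟨E2, E3, E4, f2, f3, f4, hmem₂, hrow₂⟩ :=
    midSOpen_exitLetter p M x b w t z a c τ i hσ ha' ha'0 0 hwt hQ hc0
  refine nonempty_jPkg_midSLow_core p M x b w t z a c τ i i₀ hk κ hb hσ ha ha'
    (event (ge 1) (b i.castSucc).2 (t i.castSucc)) Set.univ E2 E3 E4
    (isFinitary_event _ _ _) isFinitary_univ f2 f3 f4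
    (fun ω K₀ hF => ⟨?_, Set.mem_univ _, (hmem₂ ω K₀ hF).1, (hmem₂ ω K₀ hF).2.1, (hmem₂ ω K₀ hF).2.2⟩)
    ?_ (hrow₂ _ _ _ _)
  · obtain ⟨h0, -⟩ := hF.conn_midS i hσ ha'
    rw [event_ge]; exact mem_openConnGe_one_of_ne h0 (by rw [htz]; exact hvz)
  · -- `A^{κ,2,0,*}`: bond, `v → t` (+ the trivially witnessed `t ↔ w`)
    refine (junF_midSLow_xb_le₂ p M x b w t z a τ i hσ ha' _ _ _ _ _ _ _).trans ?_
    refine (measure_mono (genDisjOcc_pair_subset_triple _ _ (event (ge 0) (t i.castSucc) (w i.castSucc))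
      (by rw [htw]; exact empty_mem_event_ge_zero_self (w i.castSucc)) 0 1 0)).trans ?_
    rw [← htz]
    exact piPerc_midS_two_zero_le_blockAiotaSt p hb ![0, 1, 0]

/-- **The exit-class-`0` column of the lower-`★` cells, inner class generic** (dispatch form of
`nonempty_jPkg_lowStar_two_zero / _one_zero / _zero_zero`): for every inner class `c₁` a package with target
`𝟙{z_k = w_k} A^{κ,2,c₁,*}(u_k,w_k,t_k,z_k) · A^{c₁,0}(t_k,z_k,w_{k+1},u_{k+1})`.
[cite: FitznerVanDerHofstad2017, §6.1 (6.4), "Case a ≥ 2", "Case b = 0, 1, ≥ 2" (arXiv:1506.07977v2 pp. 58–59); §5.1 (5.4) (p. 48) and "Elements of the bounds" (p. 49); App. B (pp. 74–75)] -/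
theorem nonempty_jPkg_lowStar_zeroExit (i i₀ : Fin (M + 1)) (hk : i₀.succ = i.castSucc) (κ : Fin d × Bool)
    (hb : (b i.castSucc).2 = (b i.castSucc).1 + stepVec κ) (hσ : (τ i).1 = false) (c₁ : Fin 3)
    (hc : (τ i).2 = c₁) {u₀ : Unit} (ha : a i.castSucc = Sum.inr u₀) (ha' : a i.succ = Sum.inl 0) :
    Nonempty (JPkg p (jctx M x b w t z a τ i.castSucc) (JFacts M x b w t z a c τ)
      ((if z i.castSucc = w i.castSucc then
          blockAiotaSt (Letters.perc d p) κ 2 c₁ (b i.castSucc).1 (w i.castSucc) (t i.castSucc) (z i.castSucc)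
        else 0) *
        blockA (Letters.perc d p) c₁ 0 (t i.castSucc) (z i.castSucc) (w i.succ) (b i.succ).1)) := by
  obtain h0 | h1 | h2 : c₁ = 0 ∨ c₁ = 1 ∨ c₁ = 2 := by
    fin_cases c₁
    · exact Or.inl rfl
    · exact Or.inr (Or.inl rfl)
    · exact Or.inr (Or.inr rfl)
  · subst h0
    exact nonempty_jPkg_lowStar_zero_zero p M x b w t z a c τ i i₀ hk κ hb hσ hc ha ha'
  · subst h1
    exact nonempty_jPkg_lowStar_one_zero p M x b w t z a c τ i i₀ hk κ hb hσ hc ha ha'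
  · subst h2
    exact nonempty_jPkg_lowStar_two_zero p M x b w t z a c τ i i₀ hk κ hb hσ hc ha ha'

/-- **The open-exit columns `a′ ∈ {1,2}` of the lower-`★` cells off the corner `w_{k+1} ≠ t_k`, inner class
generic** (dispatch form of `nonempty_jPkg_lowStar_two_open / _one_open / _zero_open`): for every inner class
`c₁` a package with target `𝟙{z_k = w_k} A^{κ,2,c₁,*}(u_k,w_k,t_k,z_k) · A^{c₁,a′}(t_k,z_k,w_{k+1},u_{k+1})`.
[cite: FitznerVanDerHofstad2017, §6.1 (6.4), "Case a ≥ 2", "Case b = 0, 1, ≥ 2" (arXiv:1506.07977v2 pp. 58–59); §5.1 (5.4) (p. 48) and "Elements of the bounds" (p. 49); App. B (pp. 74–75)] -/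
theorem nonempty_jPkg_lowStar_open (i i₀ : Fin (M + 1)) (hk : i₀.succ = i.castSucc) (κ : Fin d × Bool)
    (hb : (b i.castSucc).2 = (b i.castSucc).1 + stepVec κ) (hσ : (τ i).1 = false) (c₁ : Fin 3)
    (hc : (τ i).2 = c₁) {u₀ : Unit} (ha : a i.castSucc = Sum.inr u₀) {a' : Fin 3} (ha' : a i.succ = Sum.inl a')
    (ha'0 : a' ≠ 0) (hwt : w i.succ ≠ t i.castSucc) :
    Nonempty (JPkg p (jctx M x b w t z a τ i.castSucc) (JFacts M x b w t z a c τ)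
      ((if z i.castSucc = w i.castSucc then
          blockAiotaSt (Letters.perc d p) κ 2 c₁ (b i.castSucc).1 (w i.castSucc) (t i.castSucc) (z i.castSucc)
        else 0) *
        blockA (Letters.perc d p) c₁ a' (t i.castSucc) (z i.castSucc) (w i.succ) (b i.succ).1)) := by
  obtain h0 | h1 | h2 : c₁ = 0 ∨ c₁ = 1 ∨ c₁ = 2 := by
    fin_cases c₁
    · exact Or.inl rfl
    · exact Or.inr (Or.inl rfl)
    · exact Or.inr (Or.inr rfl)
  · subst h0
    exact nonempty_jPkg_lowStar_zero_open p M x b w t z a c τ i i₀ hk κ hb hσ hc ha ha' ha'0 hwt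
  · subst h1
    exact nonempty_jPkg_lowStar_one_open p M x b w t z a c τ i i₀ hk κ hb hσ hc ha ha' ha'0 hwt
  · subst h2
    exact nonempty_jPkg_lowStar_two_open p M x b w t z a c τ i i₀ hk κ hb hσ hc ha ha' ha'0 hwt

end Packages

end Literature.Probability.FitznerVanDerHofstad2017

end
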